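import Summits.Ventures.GridStability.Lyapunov.StructurePreservingRate
import Summits.Ventures.GridStability.Lyapunov.StructurePreservingRoa
import Literature.Analysis.ODE.LyapunovExponentialDecay
import HarnessLib

/-!
# GridStability/Lyapunov/StructurePreservingRateRoa — EXPONENTIAL synchronisation of the
# structure-preserving model on the certified region of record, with the closed-form rate `vhRate`
# and the closed-form gain `vhGain`: `V_h(t) ≤ V_h(0)e^{−ρt}` and `V(t) ≤ 3C·V(0)·e^{−ρt}`

Cell `gridfusion` (LADDER-GRIDFUSION), seat gridfusion-lyap-1 (g7), brief «SP-RATE»; sibling of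
`StructurePreservingRate.lean` (the pointwise inequality `V̇_h ≤ −ρV_h` on the closed window ∩ momentum
leaf, `ρ = vhRate p β θ h`). Here the inequality is integrated ALONG SOLUTIONS on the certified region of
record of the energy route — `S = {V ≤ c} ∩ window ∩ leaf`, `c < c⋆(θ, β)`, the set of
`StructurePreservingRoa.sublevel_subset_regionOfAttraction` (p475989; rung «G2.b-SP NE39» p481288, ★ #45)
— which is positively invariant, so the window and the leaf hold for all `t ≥ 0` and Khalil's comparison
step applies verbatim (lit-6's `Literature.Analysis.ODE.comp_le_mul_exp_neg_of_solution₀`, Khalil Thm 4.10).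

WHAT IS PROVED (MODEL MV-3, mixed first/second order, any `n`, any coupling graph, any damping pattern;
`0 < h`, `2hMᵢ ≤ Dᵢ` on the generators; no named fact; one closed-form definition `vhGain`):
* `kinetic_le_two_mul_vh`, `phaseEnergy_le_three_mul_vh` — `K ≤ 2V_h`, `V ≤ 3V_h` (closed polytope):
  the strict function `V_h = V + hX` is equivalent to the energy of record;
* `vhGain p β θ h = max{2 + 2h·Σ_gen M/ΣD, (1 + 4h·n²·ΣD/β)/g(θ)}` and `vh_le_vhGain_mul_phaseEnergy` —
  `V_h ≤ vhGain·V` on the closed window ∩ leaf (leaf Poincaré bound + `g(θ)·Q ≤ W`);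
* **`vh_le_mul_exp_neg_of_sublevel`** — along EVERY global solution of the phase field from `S`:
  `V_h(X t) ≤ V_h(X 0)·e^{−ρt}` for all `t ≥ 0`;
* **`phaseEnergy_le_mul_exp_neg_of_sublevel`** — the ENERGY OF RECORD decays exponentially on the
  certified region of record: `V(X t) ≤ 3·vhGain·V(X 0)·e^{−ρt}`;
* `energy_le_mul_exp_neg_of_isSolution` — the same sentence read on model-2's printed second-order
  solutions `p.shifted.IsSolution δ` [cite: Padiyar2013, §3.2 eqs (3.2)–(3.5), (3.11)].

THREE COLUMNS. MODELLED: every statement is about MODEL MV-3 (`plan/MODEL-VALIDITY.md`); `ρ = vhRate`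
is a certified LOWER bound on the exponential decay rate of `V_h`/`V` inside the certified region — the
model's motions synchronise AT LEAST this fast; it is small on large networks (the `n²` walk constant) and
is never a damping figure of any grid; float modal damping ratios are VALIDATED material printed beside
such a row. CERTIFIED: nothing numeric here (instances supply `θ`, `β`, `c`, `h` and evaluate `ρ`). No
sentence of this file says that any grid is stable or well damped. Standard axioms.
-/

noncomputable section

open Set Filter Topology Real Finset
open Summit.Ventures.GridStability.Models.StructurePreserving
open Summit.Ventures.GridStability.Models.StructurePreserving.Params
open Literature.MathematicalPhysics.PowerSystems (SinusoidalCoupling.sectorGain_pos)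

namespace Summit.Ventures.GridStability.Lyapunov.StructurePreserving

variable {n : ℕ}

/-! ### `V_h` is equivalent to the energy of record -/

/-- **`K ≤ 2V_h`** for `0 ≤ h`, `2hMᵢ ≤ Dᵢ` on the generators, wherever `W ≥ 0`: `ω = (ω + hφ) − hφ`,
`ω² ≤ 2(ω + hφ)² + 2h²φ²` and `h·hMᵢ ≤ h(Dᵢ − hMᵢ)`. [folklore] -/
theorem kinetic_le_two_mul_vh {p : Params n} (hp : p.WellFormed) (δ₀ : Fin n → ℝ) {h : ℝ}
    (hh : 0 ≤ h) (hhM : ∀ i ∈ p.gen, 2 * h * p.M i ≤ p.D i) {x : (Fin n → ℝ) × (Fin n → ℝ)}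
    (hW : 0 ≤ p.potential δ₀ x.1) :
    p.kinetic x.2 ≤ 2 * (phaseEnergy p δ₀ x + h * crossTerm p δ₀ x) := by
  rw [vh_eq hp δ₀ h x]
  -- per generator: ½Mω² ≤ M(ω+hφ)² + h(D − hM)φ²
  have hterm : ∀ i ∈ p.gen, (1 / 2) * (p.M i * x.2 i ^ 2)
      ≤ p.M i * (x.2 i + h * (x.1 i - δ₀ i)) ^ 2
        + h * ((p.D i - h * p.M i) * (x.1 i - δ₀ i) ^ 2) := by
    intro i hi
    have hMi := (hp.M_pos i hi).le
    have hsq : x.2 i ^ 2 ≤ 2 * (x.2 i + h * (x.1 i - δ₀ i)) ^ 2 + 2 * (h ^ 2 * (x.1 i - δ₀ i) ^ 2) := by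
      nlinarith [sq_nonneg (x.2 i + 2 * h * (x.1 i - δ₀ i))]
    have hφ2 : 0 ≤ (x.1 i - δ₀ i) ^ 2 := sq_nonneg _
    have hDM : h * p.M i ≤ p.D i - h * p.M i := by linarith [hhM i hi]
    have h1 : (1 / 2) * (p.M i * x.2 i ^ 2)
        ≤ p.M i * (x.2 i + h * (x.1 i - δ₀ i)) ^ 2 + h * ((h * p.M i) * (x.1 i - δ₀ i) ^ 2) := by
      have := mul_le_mul_of_nonneg_left hsq hMi
      nlinarith
    have h2 : h * ((h * p.M i) * (x.1 i - δ₀ i) ^ 2) ≤ h * ((p.D i - h * p.M i) * (x.1 i - δ₀ i) ^ 2) :=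
      mul_le_mul_of_nonneg_left (mul_le_mul_of_nonneg_right hDM hφ2) hh
    linarith
  have hsum := Finset.sum_le_sum hterm
  rw [← Finset.mul_sum, Finset.sum_add_distrib, ← Finset.mul_sum] at hsum
  have hK : (1 / 2) * ∑ i ∈ p.gen, p.M i * x.2 i ^ 2 = p.kinetic x.2 := by
    unfold Params.kinetic; ring
  rw [hK] at hsum
  -- extend the generator sum of `(D − hM)φ²` to all buses (off gen the term is `Dφ² ≥ 0`)
  have hgenall : ∑ i ∈ p.gen, (p.D i - h * p.M i) * (x.1 i - δ₀ i) ^ 2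
      ≤ ∑ i, (p.D i - h * p.M i) * (x.1 i - δ₀ i) ^ 2 := by
    refine Finset.sum_le_sum_of_subset_of_nonneg (Finset.subset_univ _) fun i _ hi => ?_
    rw [hp.M_eq_zero i hi, mul_zero, sub_zero]
    exact mul_nonneg (hp.D_pos i).le (sq_nonneg _)
  have hM2 : 0 ≤ ∑ i ∈ p.gen, p.M i * (x.2 i + h * (x.1 i - δ₀ i)) ^ 2 :=
    Finset.sum_nonneg fun i hi => mul_nonneg (hp.M_pos i hi).le (sq_nonneg _)
  nlinarith [mul_le_mul_of_nonneg_left hgenall hh]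

/-- **`V ≤ 3V_h`** on the closed polytope (`|σ*| ≤ π/2`, `|σ + σ*| ≤ π` on coupled pairs, so `W ≥ 0`
by model-2's `potential_nonneg`), for `0 ≤ h`, `2hMᵢ ≤ Dᵢ` on the generators: `V = K + W`,
`K ≤ 2V_h`, `W ≤ V_h` (`potential_le_vh`). [folklore] -/
theorem phaseEnergy_le_three_mul_vh {p : Params n} (hp : p.WellFormed) (hb : ∀ i j, 0 ≤ p.b i j)
    {δ₀ : Fin n → ℝ} (h0 : ∀ i j, p.b i j ≠ 0 → |δ₀ i - δ₀ j| ≤ π / 2) {h : ℝ} (hh : 0 ≤ h)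
    (hhM : ∀ i ∈ p.gen, 2 * h * p.M i ≤ p.D i) {x : (Fin n → ℝ) × (Fin n → ℝ)}
    (hP : ∀ i j, p.b i j ≠ 0 → |(x.1 i - x.1 j) + (δ₀ i - δ₀ j)| ≤ π) :
    phaseEnergy p δ₀ x ≤ 3 * (phaseEnergy p δ₀ x + h * crossTerm p δ₀ x) := by
  have hW0 : 0 ≤ p.potential δ₀ x.1 := p.potential_nonneg hb h0 hP
  have hK := kinetic_le_two_mul_vh hp δ₀ hh hhM hW0
  have hhM' : ∀ i ∈ p.gen, h * p.M i ≤ p.D i := fun i hi => by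
    nlinarith [hhM i hi, (hp.M_pos i hi).le]
  have hWle := potential_le_vh hp δ₀ hh hhM' x
  have hV : phaseEnergy p δ₀ x = p.kinetic x.2 + p.potential δ₀ x.1 := rfl
  linarith

/-! ### The closed-form gain `V_h ≤ C·V` -/

/-- **The closed-form gain** `vhGain p β θ h = max{ 2 + 2h·Σ_gen M/ΣD, (1 + 4h·n²·ΣD/β)/g(θ) }`,
`g(θ) = (1 − sin θ)/(π/2 − θ)`: the constant with `V_h ≤ vhGain·V` on the closed window ∩ momentum leaf
(`vh_le_vhGain_mul_phaseEnergy`). Data only; no solver. [folklore] -/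
def vhGain (p : Params n) (β θ h : ℝ) : ℝ :=
  max (2 + 2 * h * (∑ i ∈ p.gen, p.M i) / (∑ i, p.D i))
    ((1 + 4 * h * (n : ℝ) ^ 2 * (∑ i, p.D i) / β) / ((1 - Real.sin θ) / (π / 2 - θ)))

/-- `2 ≤ vhGain` (so the gain is positive). [folklore] -/
theorem two_le_vhGain {p : Params n} (hp : p.WellFormed) (hn : n ≠ 0) {β θ h : ℝ} (hh : 0 ≤ h) :
    2 ≤ vhGain p β θ h := by
  have hSD : 0 < ∑ i, p.D i := sum_D_pos hp hn
  have hSM : 0 ≤ ∑ i ∈ p.gen, p.M i := Finset.sum_nonneg fun i hi => (hp.M_pos i hi).le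
  unfold vhGain
  refine le_trans ?_ (le_max_left _ _)
  have : 0 ≤ 2 * h * (∑ i ∈ p.gen, p.M i) / ∑ i, p.D i := by positivity
  linarith

/-- **`V_h ≤ vhGain·V` on the closed window ∩ momentum leaf.** Well-formed data on `n ≠ 0` buses,
susceptive couplings with `bᵢⱼ ≥ β > 0` on the edges of a preconnected coupling graph, equilibrium line
angles `|σ*| ≤ θ` (`0 ≤ θ < π/2`), `0 ≤ h`, `2hMᵢ ≤ Dᵢ` on the generators: from
`V_h ≤ 2K + hΦ + Q` (`vh_le_of_two_mul_le`), the leaf Poincaré bound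
(`sum_D_sq_le_of_mem_constraintSet`) and `g(θ)·Q ≤ W` (model-2's `potential_ge_quadratic`).
[folklore] -/
theorem vh_le_vhGain_mul_phaseEnergy {p : Params n} (hp : p.WellFormed) (hn : n ≠ 0)
    (hconn : p.couplingGraph.Preconnected) (hb : ∀ i j, 0 ≤ p.b i j) {β : ℝ} (hβ : 0 < β)
    (hβb : ∀ i j, p.couplingGraph.Adj i j → β ≤ p.b i j)
    {δ₀ : Fin n → ℝ} {θ : ℝ} (hθ0 : 0 ≤ θ) (hθ : θ < π / 2)
    (h0 : ∀ i j, p.b i j ≠ 0 → |δ₀ i - δ₀ j| ≤ θ)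
    {h : ℝ} (hh : 0 ≤ h) (hhM : ∀ i ∈ p.gen, 2 * h * p.M i ≤ p.D i)
    {x : (Fin n → ℝ) × (Fin n → ℝ)} (hx : x ∈ constraintSet p δ₀)
    (hP : ∀ i j, p.b i j ≠ 0 → |x.1 i - x.1 j| ≤ π / 2) :
    phaseEnergy p δ₀ x + h * crossTerm p δ₀ x ≤ vhGain p β θ h * phaseEnergy p δ₀ x := by
  set gθ := (1 - Real.sin θ) / (π / 2 - θ) with hgθ
  set SD : ℝ := ∑ i, p.D i with hSD
  set SM : ℝ := ∑ i ∈ p.gen, p.M i with hSM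
  set K : ℝ := p.kinetic x.2 with hK
  set Qx : ℝ := (1 / 2) * ∑ i, ∑ j, p.b i j * (((x.1 i - x.1 j) - (δ₀ i - δ₀ j)) ^ 2 / 2)
    with hQx
  set Φ : ℝ := ∑ i, p.D i * (x.1 i - δ₀ i) ^ 2 with hΦ
  set C := vhGain p β θ h with hC
  have hSDpos : 0 < SD := sum_D_pos hp hn
  have hSM0 : 0 ≤ SM := Finset.sum_nonneg fun i hi => (hp.M_pos i hi).le
  have hg : 0 < gθ := SinusoidalCoupling.sectorGain_pos hθ0 hθ
  have hK0 : 0 ≤ K := p.kinetic_nonneg (fun i hi => (hp.M_pos i hi).le) x.2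
  have hQ0 : 0 ≤ Qx := p.quadraticGap_nonneg hb δ₀ x.1
  -- V_h ≤ (2 + 2h·SM/SD)K + (1 + 4h·n²·SD/β)Q
  have hup : phaseEnergy p δ₀ x + h * crossTerm p δ₀ x
      ≤ (2 + 2 * h * SM / SD) * K + (1 + 4 * h * (n : ℝ) ^ 2 * SD / β) * Qx := by
    have hA := vh_le_of_two_mul_le hp hb δ₀ hh hhM x
    have hB := sum_D_sq_le_of_mem_constraintSet hp hn hconn hb hβ hβb hx
    rw [← hK, ← hΦ, ← hQx] at hA
    rw [← hΦ, ← hQx, ← hSD, ← hSM] at hB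
    have hB' := mul_le_mul_of_nonneg_left hB hh
    have : h * (4 * (n : ℝ) ^ 2 * SD / β * Qx + 2 * SM / SD * K)
        = (2 * h * SM / SD) * K + (4 * h * (n : ℝ) ^ 2 * SD / β) * Qx := by ring
    rw [this] at hB'
    linarith
  -- g·Q ≤ W, V = K + W
  have hW : gθ * Qx ≤ p.potential δ₀ x.1 := p.potential_ge_quadratic hb hθ0 hθ h0 hP
  have hV : phaseEnergy p δ₀ x = K + p.potential δ₀ x.1 := rfl
  have hC1 : 2 + 2 * h * SM / SD ≤ C := by rw [hC]; unfold vhGain; rw [← hSD, ← hSM]; exact le_max_left _ _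
  have hC2 : (1 + 4 * h * (n : ℝ) ^ 2 * SD / β) / gθ ≤ C := by
    rw [hC]; unfold vhGain; rw [← hSD, ← hSM, ← hgθ]; exact le_max_right _ _
  have hC0 : 0 ≤ C := le_trans (by norm_num) (two_le_vhGain hp hn hh (β := β) (θ := θ))
  -- (1 + A)Q ≤ ((1 + A)/g)·(gQ) ≤ C·W
  have hQW : (1 + 4 * h * (n : ℝ) ^ 2 * SD / β) * Qx ≤ C * p.potential δ₀ x.1 := by
    have e : (1 + 4 * h * (n : ℝ) ^ 2 * SD / β) * Qx
        = ((1 + 4 * h * (n : ℝ) ^ 2 * SD / β) / gθ) * (gθ * Qx) := by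
      field_simp
    rw [e]
    have hgQ0 : 0 ≤ gθ * Qx := mul_nonneg hg.le hQ0
    calc (1 + 4 * h * (n : ℝ) ^ 2 * SD / β) / gθ * (gθ * Qx) ≤ C * (gθ * Qx) :=
          mul_le_mul_of_nonneg_right hC2 hgQ0
      _ ≤ C * p.potential δ₀ x.1 := mul_le_mul_of_nonneg_left hW hC0
  have hKC : (2 + 2 * h * SM / SD) * K ≤ C * K := mul_le_mul_of_nonneg_right hC1 hK0
  rw [hV, mul_add]
  linarith

/-! ### Exponential decay along solutions on the certified region of record -/

/-- **Exponential decay of the strict Lyapunov function on the certified region of record.** DATA as in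
`StructurePreservingRoa.sublevel_subset_regionOfAttraction` (well-formed data on `n ≠ 0` buses,
susceptive couplings with `bᵢⱼ ≥ β > 0` on the edges of a PRECONNECTED coupling graph, a synchronous
equilibrium `δ₀` with `|δ₀ᵢ − δ₀ⱼ| ≤ θ < π/2` on coupled pairs, a level `c < c⋆(θ, β)`), plus a
cross-term weight `0 < h` with `2hMᵢ ≤ Dᵢ` on the generators. CLAIM: along EVERY global solution `X` of
the phase field with `X 0 ∈ S = {V ≤ c} ∩ window ∩ leaf`, for all `t ≥ 0`,
`V_h(X t) ≤ V_h(X 0)·exp(−vhRate·t)`, `V_h = V + hX`. Proof: `S` is positively invariant (part (b) of the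
theorem of record), so the closed window and the leaf hold along `X`; there `V̇_h ≤ −ρV_h`
(`fderiv_vh_le_neg_vhRate_mul`); Khalil's comparison step (lit-6's
`Literature.Analysis.ODE.comp_le_mul_exp_neg_of_solution₀`). MODEL MV-3; no sentence here says a grid is
stable or well damped. [cite: Khalil2002, Theorem 4.10 (proof)] -/
theorem vh_le_mul_exp_neg_of_sublevel {p : Params n} (hp : p.WellFormed) (hn : n ≠ 0)
    (hconn : p.couplingGraph.Preconnected) (hb : ∀ i j, 0 ≤ p.b i j) {β : ℝ} (hβ : 0 < β)
    (hβb : ∀ i j, p.couplingGraph.Adj i j → β ≤ p.b i j)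
    {δ₀ : Fin n → ℝ} {θ : ℝ} (hθ0 : 0 ≤ θ) (hθ : θ < π / 2)
    (h0 : ∀ i j, p.b i j ≠ 0 → |δ₀ i - δ₀ j| ≤ θ) (hδ₀ : p.IsSyncEquilibrium δ₀)
    {c : ℝ} (hc : c < levelBound θ β) {h : ℝ} (hh : 0 < h)
    (hhM : ∀ i ∈ p.gen, 2 * h * p.M i ≤ p.D i)
    {X : ℝ → (Fin n → ℝ) × (Fin n → ℝ)}
    (hX0 : X 0 ∈ window p ∩ constraintSet p δ₀ ∧ phaseEnergy p δ₀ (X 0) ≤ c)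
    (hX : ∀ T : ℝ, ∀ t ∈ Icc 0 T, HasDerivWithinAt X (phaseField p (X t)) (Icc 0 T) t)
    {t : ℝ} (ht : 0 ≤ t) :
    phaseEnergy p δ₀ (X t) + h * crossTerm p δ₀ (X t)
      ≤ (phaseEnergy p δ₀ (X 0) + h * crossTerm p δ₀ (X 0)) * Real.exp (-vhRate p β θ h * t) := by
  obtain ⟨-, hall⟩ := sublevel_subset_regionOfAttraction hp hn hconn hb hβ hβb hθ0 hθ h0 hδ₀ hc hX0
  obtain ⟨hstay, -⟩ := hall X rfl hX
  have hcd : ContDiff ℝ 1 (fun y : (Fin n → ℝ) × (Fin n → ℝ) =>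
      phaseEnergy p δ₀ y + h * crossTerm p δ₀ y) :=
    (contDiff_phaseEnergy p δ₀).add (contDiff_const.mul (contDiff_crossTerm p δ₀))
  have hVd : ∀ s ∈ Icc 0 t, HasFDerivAt (fun y : (Fin n → ℝ) × (Fin n → ℝ) =>
      phaseEnergy p δ₀ y + h * crossTerm p δ₀ y)
      (fderiv ℝ (fun y : (Fin n → ℝ) × (Fin n → ℝ) => phaseEnergy p δ₀ y + h * crossTerm p δ₀ y)
        (X s)) (X s) :=
    fun s _ => ((hcd.differentiable one_ne_zero) (X s)).hasFDerivAt
  have hle : ∀ s ∈ Icc 0 t,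
      fderiv ℝ (fun y : (Fin n → ℝ) × (Fin n → ℝ) => phaseEnergy p δ₀ y + h * crossTerm p δ₀ y)
          (X s) (phaseField p (X s))
        ≤ -vhRate p β θ h * (phaseEnergy p δ₀ (X s) + h * crossTerm p δ₀ (X s)) := by
    intro s hs
    have hmem := hstay s hs.1
    exact fderiv_vh_le_neg_vhRate_mul hp hn hconn hb hβ hβb hθ0 hθ h0 hδ₀ hh hhM hmem.1.2
      (fun i j hij => (hmem.1.1 i j hij).le)
  exact Literature.Analysis.ODE.comp_le_mul_exp_neg_of_solution₀ (hX t) hVd hle ⟨ht, le_rfl⟩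

/-- **Exponential decay of the ENERGY OF RECORD on the certified region of record** (the sentence of the
«SP-RATE» row). Under the data of `vh_le_mul_exp_neg_of_sublevel`: along EVERY global solution `X` of
the structure-preserving phase field with `X 0 ∈ S = {V ≤ c} ∩ window ∩ leaf` (`c < c⋆(θ, β)`), for all
`t ≥ 0`,
`V(X t) ≤ 3·vhGain·V(X 0)·exp(−vhRate·t)`
with the CLOSED-FORM rate `vhRate p β θ h = min{h/(1 + hΣ_gen M/ΣD), 2h·g(θ)/(1 + 4h·n²·ΣD/β)}` and gain
`vhGain p β θ h = max{2 + 2hΣ_gen M/ΣD, (1 + 4h·n²·ΣD/β)/g(θ)}`, `g(θ) = (1 − sin θ)/(π/2 − θ)` — solver-free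
and inverse-free, for every `n`, every coupling graph, every damping pattern (`V ≤ 3V_h`,
`V_h(t) ≤ V_h(0)e^{−ρt}`, `V_h(0) ≤ vhGain·V(0)`). MODEL MV-3; `ρ` is a certified lower bound on the
model's rate inside `S`, not a damping figure of any grid; no sentence here says a grid is stable.
[cite: Khalil2002, Theorem 4.10]; [cite: Padiyar2013, §3.2 eq (3.11)] -/
theorem phaseEnergy_le_mul_exp_neg_of_sublevel {p : Params n} (hp : p.WellFormed) (hn : n ≠ 0)
    (hconn : p.couplingGraph.Preconnected) (hb : ∀ i j, 0 ≤ p.b i j) {β : ℝ} (hβ : 0 < β)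
    (hβb : ∀ i j, p.couplingGraph.Adj i j → β ≤ p.b i j)
    {δ₀ : Fin n → ℝ} {θ : ℝ} (hθ0 : 0 ≤ θ) (hθ : θ < π / 2)
    (h0 : ∀ i j, p.b i j ≠ 0 → |δ₀ i - δ₀ j| ≤ θ) (hδ₀ : p.IsSyncEquilibrium δ₀)
    {c : ℝ} (hc : c < levelBound θ β) {h : ℝ} (hh : 0 < h)
    (hhM : ∀ i ∈ p.gen, 2 * h * p.M i ≤ p.D i)
    {X : ℝ → (Fin n → ℝ) × (Fin n → ℝ)}
    (hX0 : X 0 ∈ window p ∩ constraintSet p δ₀ ∧ phaseEnergy p δ₀ (X 0) ≤ c)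
    (hX : ∀ T : ℝ, ∀ t ∈ Icc 0 T, HasDerivWithinAt X (phaseField p (X t)) (Icc 0 T) t)
    {t : ℝ} (ht : 0 ≤ t) :
    phaseEnergy p δ₀ (X t)
      ≤ 3 * vhGain p β θ h * phaseEnergy p δ₀ (X 0) * Real.exp (-vhRate p β θ h * t) := by
  obtain ⟨-, hall⟩ := sublevel_subset_regionOfAttraction hp hn hconn hb hβ hβb hθ0 hθ h0 hδ₀ hc hX0
  obtain ⟨hstay, -⟩ := hall X rfl hX
  have hdec := vh_le_mul_exp_neg_of_sublevel hp hn hconn hb hβ hβb hθ0 hθ h0 hδ₀ hc hh hhM hX0 hX ht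
  have h0' : ∀ i j, p.b i j ≠ 0 → |δ₀ i - δ₀ j| ≤ π / 2 := fun i j hij => (h0 i j hij).trans hθ.le
  -- closed polytope at `X t` from the window and the equilibrium window
  have hmem := hstay t ht
  have hP : ∀ i j, p.b i j ≠ 0 → |((X t).1 i - (X t).1 j) + (δ₀ i - δ₀ j)| ≤ π := by
    intro i j hij
    have h1 := abs_lt.1 (hmem.1.1 i j hij)
    have h2 := abs_le.1 (h0' i j hij)
    exact abs_le.2 ⟨by linarith [h1.1, h2.1], by linarith [h1.2, h2.2]⟩
  have h3 := phaseEnergy_le_three_mul_vh hp hb h0' hh.le hhM hP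
  have hgain := vh_le_vhGain_mul_phaseEnergy hp hn hconn hb hβ hβb hθ0 hθ h0 hh.le hhM hX0.1.2
    (fun i j hij => (hX0.1.1 i j hij).le)
  have hexp : 0 ≤ Real.exp (-vhRate p β θ h * t) := (Real.exp_pos _).le
  calc phaseEnergy p δ₀ (X t)
      ≤ 3 * (phaseEnergy p δ₀ (X t) + h * crossTerm p δ₀ (X t)) := h3
    _ ≤ 3 * ((phaseEnergy p δ₀ (X 0) + h * crossTerm p δ₀ (X 0))
          * Real.exp (-vhRate p β θ h * t)) := by linarith
    _ ≤ 3 * ((vhGain p β θ h * phaseEnergy p δ₀ (X 0)) * Real.exp (-vhRate p β θ h * t)) := by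
        have := mul_le_mul_of_nonneg_right hgain hexp
        linarith
    _ = 3 * vhGain p β θ h * phaseEnergy p δ₀ (X 0) * Real.exp (-vhRate p β θ h * t) := by ring

/-! ### Back to the printed second-order form -/

/-- **The «SP-RATE» sentence in the printed vocabulary (frame rotating at `ω₀`).** Under the data of
`phaseEnergy_le_mul_exp_neg_of_sublevel`, every solution `δ` of the shifted structure-preserving model in
model-2's second-order sense (`p.shifted.IsSolution δ`: (3.2) with `P̄`) whose initial state has every
coupled branch inside `|δᵢ(0) − δⱼ(0)| < π/2`, momentum `L(δ(0), δ̇(0)) = L(δ₀, 0)` and energy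
`V(δ(0), δ̇(0)) ≤ c < c⋆(θ, β)` satisfies, for all `t ≥ 0`,
`V(δ(t), δ̇(t)) ≤ 3·vhGain·V(δ(0), δ̇(0))·exp(−vhRate·t)`: the Bergen–Hill energy of MODEL MV-3 decays
exponentially with a closed-form rate on the certified region of record. No sentence here says a grid is
stable or well damped. [cite: Padiyar2013, §3.2 eqs (3.2)–(3.5), (3.11)]; [cite: Khalil2002, Theorem 4.10] -/
theorem energy_le_mul_exp_neg_of_isSolution {p : Params n} (hp : p.WellFormed) (hn : n ≠ 0)
    (hconn : p.couplingGraph.Preconnected) (hb : ∀ i j, 0 ≤ p.b i j) {β : ℝ} (hβ : 0 < β)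
    (hβb : ∀ i j, p.couplingGraph.Adj i j → β ≤ p.b i j)
    {δ₀ : Fin n → ℝ} {θ : ℝ} (hθ0 : 0 ≤ θ) (hθ : θ < π / 2)
    (h0 : ∀ i j, p.b i j ≠ 0 → |δ₀ i - δ₀ j| ≤ θ) (hδ₀ : p.IsSyncEquilibrium δ₀)
    {c : ℝ} (hc : c < levelBound θ β) {h : ℝ} (hh : 0 < h)
    (hhM : ∀ i ∈ p.gen, 2 * h * p.M i ≤ p.D i)
    {δ : ℝ → Fin n → ℝ} (hδ : p.shifted.IsSolution δ)
    (hwin : ∀ i j, p.b i j ≠ 0 → |δ 0 i - δ 0 j| < π / 2)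
    (hL : p.momentum (δ 0) (fun i => deriv (fun u => δ u i) 0) = p.momentum δ₀ 0)
    (hV : p.energy δ₀ (δ 0) (fun i => deriv (fun u => δ u i) 0) ≤ c) {t : ℝ} (ht : 0 ≤ t) :
    p.energy δ₀ (δ t) (fun i => deriv (fun u => δ u i) t)
      ≤ 3 * vhGain p β θ h * p.energy δ₀ (δ 0) (fun i => deriv (fun u => δ u i) 0)
        * Real.exp (-vhRate p β θ h * t) := by
  set X : ℝ → (Fin n → ℝ) × (Fin n → ℝ) :=
    fun s => (δ s, fun i => if i ∈ p.gen then deriv (fun u => δ u i) s else 0) with hXdef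
  have hgen : ∀ s, ∀ i ∈ p.gen, (X s).2 i = deriv (fun u => δ u i) s := fun s i hi => by
    simp [hXdef, hi]
  have hXsol : ∀ T : ℝ, ∀ t ∈ Icc 0 T, HasDerivWithinAt X (phaseField p (X t)) (Icc 0 T) t :=
    fun T t _ => (hasDerivAt_phase_of_isSolution hp hδ t).hasDerivWithinAt
  have hy : X 0 ∈ window p ∩ constraintSet p δ₀ ∧ phaseEnergy p δ₀ (X 0) ≤ c := by
    refine ⟨⟨hwin, ?_, fun i hi => by simp [hXdef, hi]⟩, ?_⟩
    · rw [momentum_congr_gen p (δ 0) (hgen 0)]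
      exact hL
    · rw [phaseEnergy_apply, energy_congr_gen p δ₀ (δ 0) (hgen 0)]
      exact hV
  have h := phaseEnergy_le_mul_exp_neg_of_sublevel hp hn hconn hb hβ hβb hθ0 hθ h0 hδ₀ hc hh hhM
    hy hXsol ht
  rw [phaseEnergy_apply, phaseEnergy_apply, energy_congr_gen p δ₀ (δ t) (hgen t),
    energy_congr_gen p δ₀ (δ 0) (hgen 0)] at h
  exact h

end Summit.Ventures.GridStability.Lyapunov.StructurePreserving

end
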